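import Summits.CriticalPhenomena.SAWScalingLimit.Theorems.SAWWeldingIdentificationWeldingContinuityBanks
import Summits.CriticalPhenomena.SAWScalingLimit.Theorems.SAWWeldingIdentificationWeldingContinuityConfig
import Literature.Probability.RandomPlanarGeometry.ConformalWelding

/-!
# Welding continuity, part F1: the welding equation of a chord in disc-chart coordinates

Support file for item `stmt-CriticalPhenomena-4509` (`SAWWeldingIdentification.WeldingContinuity`).

Given a welding functional `W` PINNED by the route's hypothesis (for every simple chord, sign,
banks and normalised uniformisers, `W Q γ x > 0` solves `ψ̄ (s x) = φ̄ (-s · W Q γ x)`), a simple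
chord `γ` of the conformal rectangle `Q` with real parametrisation `P`, its two banks `DL`, `DR`
(part B) and disc charts `f_L : 𝔻 → DL`, `f_R : 𝔻 → DR` with Carathéodory extensions `F_L`,
`F_R`, we BUILD a welding configuration (part C2: sign `s = index of ∂Ω`, normalised uniformisers
`φ = f_L ∘ (ζ_b^L ·) ∘ cayley ∘ (|v_L| · + u_L)`, `ψ` likewise) and read the pinning identity in
disc coordinates (`exists_weldData`):

`F_R (ζ_b^R · C(|v_R| s x + u_R)) = F_L (ζ_b^L · C(-|v_L| s W Q γ x + u_L))`, `C = cayleyFun`,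

together with the characterisation of all the circle points and Cayley parameters involved. This
is the form in which part E passes to the limit.

References: Pommerenke (1992), §2.3 (Thm. 2.6, Cor. 2.7; proof of Cor. 2.8); Sheffield (2016), §1.4.
-/

noncomputable section

open Set Filter Metric Complex
open scoped Topology
open UpperHalfPlane (upperHalfPlaneSet)
open Literature.Probability.RandomPlanarGeometry Literature.Topology.PlaneTopology

namespace Summit.CriticalPhenomena.SAWScalingLimit.Theorems.WeldingContinuity

/-! ### The parameters of `c_L`, `c_R` on the bank loops -/

/-- The parameter `t_c ∈ (1/2, 1)` at which the left bank loop passes through `c_L = Q.pt 1`.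
[folklore] -/
theorem exists_param_left (Q : ConformalRectangle) :
    ∃ tc : ℝ, 1 / 2 < tc ∧ tc < 1 ∧
      Q.boundary (Q.mark 2 + (2 * tc - 1) * (Q.mark 0 - Q.mark 2)) = Q.pt 1 := by
  have h01 : Q.mark 0 < Q.mark 1 := Q.strictMono_mark (by decide)
  have h12 : Q.mark 1 < Q.mark 2 := Q.strictMono_mark (by decide)
  have hd : 0 < Q.mark 2 - Q.mark 0 := by linarith
  set uc : ℝ := (Q.mark 2 - Q.mark 1) / (Q.mark 2 - Q.mark 0) with huc
  have huc0 : 0 < uc := div_pos (by linarith) hd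
  have huc1 : uc < 1 := (div_lt_one hd).2 (by linarith)
  refine ⟨(1 + uc) / 2, by linarith, by linarith, ?_⟩
  have e : Q.mark 2 + (2 * ((1 + uc) / 2) - 1) * (Q.mark 0 - Q.mark 2) = Q.mark 1 := by
    rw [huc]; field_simp; ring
  rw [e]; rfl

/-- The parameter `t_c ∈ (1/2, 1)` at which the right bank loop passes through `c_R = Q.pt 3`.
[folklore] -/
theorem exists_param_right (Q : ConformalRectangle) :
    ∃ tc : ℝ, 1 / 2 < tc ∧ tc < 1 ∧
      Q.boundary (Q.mark 2 + (2 * tc - 1) * (Q.mark 0 + 1 - Q.mark 2)) = Q.pt 3 := by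
  have h23 : Q.mark 2 < Q.mark 3 := Q.strictMono_mark (by decide)
  have h30 : Q.mark 3 < Q.mark 0 + 1 := by linarith [(Q.mark_mem 3).2, (Q.mark_mem 0).1]
  have hd : 0 < Q.mark 0 + 1 - Q.mark 2 := by linarith
  set uc : ℝ := (Q.mark 3 - Q.mark 2) / (Q.mark 0 + 1 - Q.mark 2) with huc
  have huc0 : 0 < uc := div_pos (by linarith) hd
  have huc1 : uc < 1 := (div_lt_one hd).2 (by linarith)
  refine ⟨(1 + uc) / 2, by linarith, by linarith, ?_⟩
  have e : Q.mark 2 + (2 * ((1 + uc) / 2) - 1) * (Q.mark 0 + 1 - Q.mark 2) = Q.mark 3 := by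
    rw [huc]; field_simp; ring
  rw [e]; rfl

/-- Values of a concatenated bank loop: at `0` it is `P 0`. [folklore] -/
theorem bankLoop_zero {D : JordanDomain} {P A : ℝ → ℂ} (hD : D.boundary = concatPath P A ∘ Int.fract) :
    D.boundary 0 = P 0 := by
  rw [hD, Function.comp_apply, Int.fract_zero, concatPath_zero]

/-- Values of a concatenated bank loop: at `1/2` it is `P 1`. [folklore] -/
theorem bankLoop_half {D : JordanDomain} {P A : ℝ → ℂ} (hD : D.boundary = concatPath P A ∘ Int.fract) :
    D.boundary (1 / 2) = P 1 := by
  rw [hD, Function.comp_apply, Int.fract_eq_self.2 ⟨by norm_num, by norm_num⟩, concatPath_half]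

/-- Values of a concatenated bank loop on `(1/2, 1)`: `A (2t - 1)`. [folklore] -/
theorem bankLoop_of_half_lt {D : JordanDomain} {P A : ℝ → ℂ}
    (hD : D.boundary = concatPath P A ∘ Int.fract) {t : ℝ} (ht : 1 / 2 < t) (ht1 : t < 1) :
    D.boundary t = A (2 * t - 1) := by
  rw [hD, Function.comp_apply, Int.fract_eq_self.2 ⟨by linarith, ht1⟩, concatPath_of_half_lt ht]

/-! ### The welding equation in disc coordinates -/

/-- **The welding equation of a simple chord in disc-chart coordinates.** See the module
docstring: from the pinned welding functional `W`, a simple chord `γ` with parametrisation `P`,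
its banks `DL, DR` with disc charts and Carathéodory extensions `F_L, F_R`, points `z_L ∈ DL`,
`z_R ∈ DR` and the sign `s = Q.index z_L = ±1`, we obtain circle points `ζ^L_{a,b,c}`,
`ζ^R_{a,b,c}` over `a, b, c_L` resp. `a, b, c_R`, their Cayley parameters, and the identity
`F_R (ζ_b^R C(|u_R' - u_R| s x + u_R)) = F_L (ζ_b^L C(-|u_L' - u_L| s W Q γ x + u_L))` with
`W Q γ x > 0`. [cite: PommerenkeBBCM1992, §2.3 Thm. 2.6 and Cor. 2.7] -/
theorem exists_weldData (W : ConformalRectangle → CurveClass ℂ → ℝ → ℝ)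
    (hpin : ∀ (Q : ConformalRectangle) (γ : CurveClass ℂ) (s : ℝ) (L R : Set ℂ)
      (φ : ConformalEquiv upperHalfPlaneSet L) (ψ : ConformalEquiv upperHalfPlaneSet R),
      (γ ∈ CurveClass.simple ∧ γ.source = Q.pt 0 ∧ γ.target = Q.pt 2 ∧
        γ.range ⊆ closure Q.carrier ∧ γ.range ∩ frontier Q.carrier ⊆ {Q.pt 0, Q.pt 2}) →
      (s = 1 ∨ s = -1) →
      (L ∪ R = Q.carrier \ γ.range ∧ Disjoint L R ∧ IsOpen L ∧ IsOpen R ∧ IsConnected L ∧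
        IsConnected R ∧ Q.pt 1 ∈ closure L ∧ Q.pt 3 ∈ closure R) →
      (φ.HasBoundaryValue 0 (Q.pt 0) ∧ φ.HasBoundaryValueAtInfty (Q.pt 2) ∧
        φ.HasBoundaryValue ((s : ℝ) : ℂ) (Q.pt 1) ∧ ψ.HasBoundaryValue 0 (Q.pt 0) ∧
        ψ.HasBoundaryValueAtInfty (Q.pt 2) ∧ ψ.HasBoundaryValue (-((s : ℝ) : ℂ)) (Q.pt 3)) →
      ∀ x : ℝ, 0 < x → 0 < W Q γ x ∧
        ψ.boundaryExtension (((s * x : ℝ)) : ℂ) = φ.boundaryExtension (((-(s * W Q γ x) : ℝ)) : ℂ))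
    (Q : ConformalRectangle) {γ : CurveClass ℂ} (hγ : (Q.chord 0 2 (by decide)).IsSimpleChord γ)
    {P : ℝ → ℂ} (hPc : Continuous P) (hP0 : P 0 = Q.pt 0) (hP1 : P 1 = Q.pt 2)
    (hPim : P '' Icc 0 1 = γ.range) {DL DR : JordanDomain}
    (hDLb : DL.boundary = concatPath P (fun u => Q.boundary (Q.mark 2 + u * (Q.mark 0 - Q.mark 2))) ∘ Int.fract)
    (hDRb : DR.boundary = concatPath P (fun u => Q.boundary (Q.mark 2 + u * (Q.mark 0 + 1 - Q.mark 2))) ∘ Int.fract)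
    (hun : DL.carrier ∪ DR.carrier = Q.carrier \ P '' Icc 0 1) (hdj : Disjoint DL.carrier DR.carrier)
    (hfL : frontier DL.carrier = P '' Icc 0 1 ∪ Q.boundary '' Icc (Q.mark 0) (Q.mark 2))
    (hfR : frontier DR.carrier = P '' Icc 0 1 ∪ Q.boundary '' Icc (Q.mark 2) (Q.mark 0 + 1))
    {zL zR : ℂ} (hzL : zL ∈ DL.carrier) (hzR : zR ∈ DR.carrier)
    (fL : ConformalEquiv (ball (0 : ℂ) 1) DL.carrier) {FL : ℂ → ℂ}
    (hFLc : ContinuousOn FL (closedBall 0 1)) (hFLeq : EqOn FL fL (ball 0 1))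
    (hFLinj : InjOn FL (closedBall 0 1)) (hFLsph : BijOn FL (sphere 0 1) (frontier DL.carrier))
    (fR : ConformalEquiv (ball (0 : ℂ) 1) DR.carrier) {FR : ℂ → ℂ}
    (hFRc : ContinuousOn FR (closedBall 0 1)) (hFReq : EqOn FR fR (ball 0 1))
    (hFRinj : InjOn FR (closedBall 0 1)) (hFRsph : BijOn FR (sphere 0 1) (frontier DR.carrier))
    {s : ℝ} (hs : s = 1 ∨ s = -1) (hsQ : (Q.index zL : ℝ) = s) {x : ℝ} (hx : 0 < x) :
    ∃ (ζaL ζbL ζcL ζaR ζbR ζcR : ℂ) (uL uL' uR uR' : ℝ),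
      ζaL ∈ sphere (0 : ℂ) 1 ∧ ζbL ∈ sphere (0 : ℂ) 1 ∧ ζcL ∈ sphere (0 : ℂ) 1 ∧
        FL ζaL = Q.pt 0 ∧ FL ζbL = Q.pt 2 ∧ FL ζcL = Q.pt 1 ∧
        uL = (cayleyInvFun (ζbL⁻¹ * ζaL)).re ∧ uL' = (cayleyInvFun (ζbL⁻¹ * ζcL)).re ∧
        uL' - uL ≠ 0 ∧
      ζaR ∈ sphere (0 : ℂ) 1 ∧ ζbR ∈ sphere (0 : ℂ) 1 ∧ ζcR ∈ sphere (0 : ℂ) 1 ∧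
        FR ζaR = Q.pt 0 ∧ FR ζbR = Q.pt 2 ∧ FR ζcR = Q.pt 3 ∧
        uR = (cayleyInvFun (ζbR⁻¹ * ζaR)).re ∧ uR' = (cayleyInvFun (ζbR⁻¹ * ζcR)).re ∧
        uR' - uR ≠ 0 ∧
      0 < W Q γ x ∧
      FR (ζbR * cayleyFun (((|uR' - uR| : ℝ) : ℂ) * ((s * x : ℝ) : ℂ) + uR)) =
        FL (ζbL * cayleyFun (((|uL' - uL| : ℝ) : ℂ) * ((-(s * W Q γ x) : ℝ) : ℂ) + uL)) := by
  -- indices of the banks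
  have hzLQ : zL ∈ Q.carrier := (left_subset hun hzL).1
  have hzRQ : zR ∈ Q.carrier := (right_subset hun hzR).1
  have hιL : (DL.index zL : ℝ) = -s := by
    rw [index_left_eq hun hdj hfR hDLb hDRb hPc hP0 hP1 hzL]
    push_cast
    rw [hsQ]
  have hιR : (DR.index zR : ℝ) = -(-s) := by
    rw [index_right_eq hun hdj hfL hDLb hDRb hPc hP0 hP1 hzR,
      Q.toJordanDomain.index_eq_of_mem_carrier hzRQ hzLQ, neg_neg]
    exact hsQ
  have hs' : -s = 1 ∨ -s = -1 := by rcases hs with rfl | rfl <;> norm_num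
  -- parameters of `c_L`, `c_R`
  obtain ⟨tcL, htcL, htcL1, hcL⟩ := exists_param_left Q
  obtain ⟨tcR, htcR, htcR1, hcR⟩ := exists_param_right Q
  have hbL0 : DL.boundary 0 = Q.pt 0 := by rw [bankLoop_zero hDLb, hP0]
  have hbLh : DL.boundary (1 / 2) = Q.pt 2 := by rw [bankLoop_half hDLb, hP1]
  have hbLc : DL.boundary tcL = Q.pt 1 := by
    rw [bankLoop_of_half_lt hDLb htcL htcL1, ← hcL]
  have hbR0 : DR.boundary 0 = Q.pt 0 := by rw [bankLoop_zero hDRb, hP0]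
  have hbRh : DR.boundary (1 / 2) = Q.pt 2 := by rw [bankLoop_half hDRb, hP1]
  have hbRc : DR.boundary tcR = Q.pt 3 := by
    rw [bankLoop_of_half_lt hDRb htcR htcR1, ← hcR]
  -- the two normalised uniformisers
  obtain ⟨ζaL, ζbL, ζcL, uL, uL', φ, hζaL, hζbL, hζcL, hFaL, hFbL, hFcL, huL, huL', hv0L, -,
    hφt, -, hφ0, hφi, hφc⟩ :=
    exists_normalisedMap DL hzL (tb := 1 / 2) (tc := tcL) one_half_pos htcL htcL1 fL hFLc hFLeq
      hFLinj hFLsph hs hιL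
  obtain ⟨ζaR, ζbR, ζcR, uR, uR', ψ, hζaR, hζbR, hζcR, hFaR, hFbR, hFcR, huR, huR', hv0R, -,
    hψt, -, hψ0, hψi, hψc⟩ :=
    exists_normalisedMap DR hzR (tb := 1 / 2) (tc := tcR) one_half_pos htcR htcR1 fR hFRc hFReq
      hFRinj hFRsph hs' hιR
  rw [hbL0] at hFaL hφ0
  rw [hbLh] at hFbL hφi
  rw [hbLc] at hFcL hφc
  rw [hbR0] at hFaR hψ0
  rw [hbRh] at hFbR hψi
  rw [hbRc] at hFcR hψc
  have hψc' : ψ.HasBoundaryValue (-((s : ℝ) : ℂ)) (Q.pt 3) := by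
    have e : (((-s : ℝ)) : ℂ) = -((s : ℝ) : ℂ) := by push_cast; ring
    rw [← e]; exact hψc
  -- pin the welding functional on this configuration
  have hun' : DL.carrier ∪ DR.carrier = Q.carrier \ γ.range := by rw [hun, hPim]
  have hpinned := hpin Q γ s DL.carrier DR.carrier φ ψ hγ hs
    ⟨hun', hdj, DL.isOpen, DR.isOpen, DL.isConnected, DR.isConnected,
      pt_one_mem_closure_left hfL, pt_three_mem_closure_right hfR⟩
    ⟨hφ0, hφi, hφc, hψ0, hψi, hψc'⟩ x hx
  obtain ⟨hpos, hweld⟩ := hpinned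
  rw [boundaryExtension_threePointMap hψt (by simp), boundaryExtension_threePointMap hφt (by simp)]
    at hweld
  exact ⟨ζaL, ζbL, ζcL, ζaR, ζbR, ζcR, uL, uL', uR, uR',
    hζaL, hζbL, hζcL, hFaL, hFbL, hFcL, huL, huL', hv0L,
    hζaR, hζbR, hζcR, hFaR, hFbR, hFcR, huR, huR', hv0R, hpos, hweld⟩

end Summit.CriticalPhenomena.SAWScalingLimit.Theorems.WeldingContinuity

end
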